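import Literature.NumberTheory.Transcendental.KZCalculus

/-!
# Route ValuedFieldSpecialisation — crux `ParametricLifting` (stmt-KontsevichZagierPeriods-3498):
glue W1, every formal combination lives on some dimension level

Helper (`--supports`) for item stmt-KontsevichZagierPeriods-3498 (line `registered`, graded reshape,
lead c7). The reshaped skeleton proves the kernel statement level by level, level `E` being the
subgroup `AddSubgroup.closure {y | ∃ n (r : KZ.IntegralRep n), n < E ∧ y = KZ.of r}` of formal
combinations supported on representations of dimension `< E`. This file supplies the exhaustion:
every `x : KZ.FormalRep` lies on some level (`stub_exists_dimBound`), by induction on the free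
abelian group (a generator `[r]`, `r : KZ.IntegralRep n`, lies on level `n + 1`; levels are monotone
in `E`, take `max` for sums).

Sources: M. Kontsevich, D. Zagier, *Periods* (2001), §1.2 (the formal group of integral
representations); the statement itself is elementary free-abelian-group bookkeeping.
-/

noncomputable section

namespace Summit.KontsevichZagierPeriods.ValuedFieldSpecialisation

open Literature.NumberTheory.Transcendental

/-- The dimension levels `closure {[r] | dim r < E}` are monotone in `E`. [folklore] -/
theorem dimLevel_mono {E E' : ℕ} (h : E ≤ E') :
    AddSubgroup.closure {y : KZ.FormalRep | ∃ (n : ℕ) (r : KZ.IntegralRep n), n < E ∧ y = KZ.of r} ≤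
      AddSubgroup.closure {y : KZ.FormalRep | ∃ (n : ℕ) (r : KZ.IntegralRep n), n < E' ∧ y = KZ.of r} :=
  AddSubgroup.closure_mono fun _ ⟨n, r, hn, hy⟩ => ⟨n, r, lt_of_lt_of_le hn h, hy⟩

/-- **Glue W1 — every formal combination lives on some dimension level.** `x ∈ closure {[r] | dim r < E}`
for some `E`: induction on the free abelian group (`FreeAbelianGroup.induction_on`; a generator `[r]`,
`r : KZ.IntegralRep n`, lies on level `n + 1`; levels are monotone in `E`, take `max` for sums). [folklore] -/
theorem stub_exists_dimBound :
    ∀ x : KZ.FormalRep, ∃ E : ℕ, x ∈ AddSubgroup.closure {y : KZ.FormalRep | ∃ (n : ℕ) (r : KZ.IntegralRep n), n < E ∧ y = KZ.of r} := by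
  intro x
  induction x using FreeAbelianGroup.induction_on with
  | zero => exact ⟨0, zero_mem _⟩
  | of y =>
    obtain ⟨n, r⟩ := y
    exact ⟨n + 1, AddSubgroup.subset_closure ⟨n, r, Nat.lt_succ_self n, rfl⟩⟩
  | neg y hy =>
    obtain ⟨E, hE⟩ := hy
    exact ⟨E, neg_mem hE⟩
  | add y z hy hz =>
    obtain ⟨E₁, hE₁⟩ := hy
    obtain ⟨E₂, hE₂⟩ := hz
    exact ⟨max E₁ E₂, add_mem (dimLevel_mono (le_max_left E₁ E₂) hE₁)
      (dimLevel_mono (le_max_right E₁ E₂) hE₂)⟩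

end Summit.KontsevichZagierPeriods.ValuedFieldSpecialisation
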